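import Summits.Ventures.LatticeQCDFlow.Exactness.ReversiblePositive
import HarnessLib

/-!
# Adjoint pairs of exact samplers on an admissible class: equal autocovariances at every lag, the adjoint of a contraction is a contraction, the additive reversibilization `½(K + K†)` is a REVERSIBLE exact sampler with the same Dirichlet form, and the palindrome `K K†` is a POSITIVE one

HONEST FRAMING: exact (Metropolis-corrected) sampling algorithms for lattice gauge theory;
figures of merit are autocorrelation/cost numbers at stated couplings and volumes; no
continuum-physics claim.

Venture `LatticeQCDFlow` (cell pub-lqcd), topic `Exactness`; FANOUT row 8 (`s0-cpn-nemc`, GEN-24).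
NEW WORK of the cell in row 2's format `RevOp` (`Exactness/ReversibleOperatorL2.lean`,
`ReversibleNeumannSums.lean`: weight `w ≥ 0`, admissible class `A` with (int) (comb), operators with
(stab) (lin) (contr) and possibly (symm)).  Elementary; nothing is cited as a fact.  Printed
counterparts NAMED ONLY: Neal 2004 (*Improving asymptotic variance of MCMC estimators: non-reversible
chains are better*; "mutually reversible" pairs), Fill 1991 / Bierkens 2016 (additive
reversibilization).  The kernel-level version (Mathlib `Kernel`s, row 9's `IsAdjointPair`) is
`Scoring/AdjointKernelAutocovariance.lean`; this file is the operator-level one, which also serves row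
2's lattice operators that are not given as kernels (HMC with partial momentum refresh, ordered
Metropolis scans).

## Setting

Two operators `K`, `K'` on the class with the ADJOINT RELATION
`∫ (K f) h w = ∫ f (K' h) w` for all `f, h ∈ A` (a reversible `K` is the case `K' = K`).  The
symmetrised operator is given by an identity ON THE CLASS, `S f = ½(K f + K' f)` for `f ∈ A` (no
definition is introduced).

## What is proved (namespace `RevOp`; `C_K(k) = ∫ g (Kᵏ g) w`)

* `half_add_mem`, `integral_half_add_mul`, `integral_half_add_sq_le` — class bookkeeping for midpoints;
* `iterate_adjoint` — `∫ (Kᵐ f) h w = ∫ f (K'ᵐ h) w`; **`autocov_eq_of_adjoint`** — `C_K(k) = C_{K'}(k)`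
  for every `g ∈ A` and every lag (TIME REVERSAL DOES NOT CHANGE AUTOCOVARIANCES), hence equal Abel
  sums (`abelSum_eq_of_adjoint`) and equal `τ_int` (`tauInt_eq_of_adjoint`); `quadForm_eq_of_adjoint` —
  `∫ v (K v) w = ∫ v (K' v) w`;
* **`contr_of_adjoint`** — if `K` is a contraction on the class then so is its adjoint `K'`
  (`‖K'f‖² = ⟨K K' f, f⟩ ≤ ‖K K' f‖ ‖f‖ ≤ ‖K' f‖ ‖f‖`);
* **`addRev_mem`, `addRev_lin`, `addRev_symm`, `addRev_contr`, `quadForm_addRev_eq`** — `S = ½(K + K')`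
  satisfies (stab) (lin) (SYMM) (contr) on the class and `∫ v (S v) w = ∫ v (K v) w`: the additive
  reversibilization is a reversible exact sampler with the Dirichlet form of `K` — the comparison partner
  of `Exactness/NonreversibleDirichletComparison` (the comparison itself: companion file);
* **`palin_mem`, `palin_lin`, `palin_symm`, `palin_contr`, `palin_pos`** — the PALINDROME `P = K ∘ K'`
  (the update followed by its time reversal, e.g. a forward then a backward sweep) is a reversible AND
  POSITIVE exact sampler on the class (`∫ f (P f) w = ∫ (K' f)² w ≥ 0`), hence
  (`Exactness/ReversiblePositive`) **`palin_autocov_nonneg`**, **`palin_autocov_succ_le`** — under `P`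
  every observable has nonnegative, nonincreasing autocovariances at every lag.

NOT CLAIMED: existence of an adjoint on a given class (hypothesis); cross-covariances of two observables
(direction-dependent); any number of ours.
-/

namespace Summit.Ventures.LatticeQCDFlow.Exactness

open Real MeasureTheory Filter Finset
open Summit.Ventures.LatticeQCDFlow.Scoring

namespace RevOp

variable {X : Type*} [MeasurableSpace X] {μ : Measure X} {w : X → ℝ} {A : (X → ℝ) → Prop}
  {K K' S P : (X → ℝ) → (X → ℝ)}

/-! ## §0 Midpoints in the class -/

omit [MeasurableSpace X] in
/-- The class is closed under midpoints: `f, h ∈ A ⇒ ½(f + h) ∈ A` (from (comb)). -/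
theorem half_add_mem (hAc : ∀ ⦃f h : X → ℝ⦄ (c : ℝ), A f → A h → A (fun x => f x + c * h x))
    {f h : X → ℝ} (hf : A f) (hh : A h) : A (fun x => (f x + h x) / 2) := by
  have hu := hAc 1 hf hh
  have e : (fun x => (f x + 1 * h x) + (-1 / 2 : ℝ) * (f x + 1 * h x)) = fun x => (f x + h x) / 2 := by
    funext x; ring
  rw [← e]
  exact hAc (-1 / 2) hu hu

/-- `∫ ((a + b)/2) h w = ½ ∫ a h w + ½ ∫ b h w` on the class. -/
theorem integral_half_add_mul
    (hAi : ∀ ⦃f h : X → ℝ⦄, A f → A h → Integrable (fun x => f x * h x * w x) μ)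
    {a b h : X → ℝ} (ha : A a) (hb : A b) (hh : A h) :
    ∫ x, (a x + b x) / 2 * h x * w x ∂μ
      = (∫ x, a x * h x * w x ∂μ) / 2 + (∫ x, b x * h x * w x ∂μ) / 2 := by
  have e : ∀ x, (a x + b x) / 2 * h x * w x
      = (1 / 2) * (a x * h x * w x) + (1 / 2) * (b x * h x * w x) := fun x => by ring
  simp_rw [e]
  rw [integral_add ((hAi ha hh).const_mul _) ((hAi hb hh).const_mul _), integral_const_mul,
    integral_const_mul]
  ring

/-- `∫ ((a + b)/2)² w ≤ ½ ∫ a² w + ½ ∫ b² w` on the class (convexity of the square). -/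
theorem integral_half_add_sq_le (hw0 : ∀ x, 0 ≤ w x)
    (hAi : ∀ ⦃f h : X → ℝ⦄, A f → A h → Integrable (fun x => f x * h x * w x) μ)
    {a b : X → ℝ} (ha : A a) (hb : A b) :
    ∫ x, ((a x + b x) / 2) ^ 2 * w x ∂μ
      ≤ (∫ x, a x ^ 2 * w x ∂μ) / 2 + (∫ x, b x ^ 2 * w x ∂μ) / 2 := by
  have ia := integrable_sq_mul hAi ha
  have ib := integrable_sq_mul hAi hb
  have e : (∫ x, a x ^ 2 * w x ∂μ) / 2 + (∫ x, b x ^ 2 * w x ∂μ) / 2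
      = ∫ x, ((1 / 2) * (a x ^ 2 * w x) + (1 / 2) * (b x ^ 2 * w x)) ∂μ := by
    rw [integral_add (ia.const_mul _) (ib.const_mul _), integral_const_mul, integral_const_mul]; ring
  rw [e]
  refine integral_mono_of_nonneg (Eventually.of_forall fun x => mul_nonneg (sq_nonneg _) (hw0 x))
    ((ia.const_mul _).add (ib.const_mul _)) (Eventually.of_forall fun x => ?_)
  have : 0 ≤ ((a x - b x) / 2) ^ 2 * w x := mul_nonneg (sq_nonneg _) (hw0 x)
  nlinarith [this]

/-! ## §1 Adjoint pairs: equal autocovariances, contraction transfers -/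

section Adjoint

variable (hAK : ∀ ⦃f : X → ℝ⦄, A f → A (K f)) (hAK' : ∀ ⦃f : X → ℝ⦄, A f → A (K' f))
  (hadj : ∀ ⦃f h : X → ℝ⦄, A f → A h → ∫ x, K f x * h x * w x ∂μ = ∫ x, f x * K' h x * w x ∂μ)

include hAK hAK' hadj in
/-- **Iterates of an adjoint pair are adjoint**: `∫ (Kᵐ f) h w = ∫ f (K'ᵐ h) w`. -/
theorem iterate_adjoint : ∀ (m : ℕ) {f h : X → ℝ}, A f → A h →
    ∫ x, (K^[m] f) x * h x * w x ∂μ = ∫ x, f x * (K'^[m] h) x * w x ∂μ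
  | 0, _, _, _, _ => by simp
  | m + 1, f, h, hf, hh => by
    rw [Function.iterate_succ_apply, iterate_adjoint m (hAK hf) hh, hadj hf (iterate_mem hAK' m hh),
      Function.iterate_succ_apply']

include hAK hAK' hadj in
/-- **TIME REVERSAL DOES NOT CHANGE AUTOCOVARIANCES**: `∫ g (Kᵏ g) w = ∫ g (K'ᵏ g) w` for every
`g ∈ A` and every lag `k`. -/
theorem autocov_eq_of_adjoint {g : X → ℝ} (hg : A g) (k : ℕ) :
    ∫ x, g x * (K^[k] g) x * w x ∂μ = ∫ x, g x * (K'^[k] g) x * w x ∂μ := by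
  have e : ∫ x, g x * (K^[k] g) x * w x ∂μ = ∫ x, (K^[k] g) x * g x * w x ∂μ :=
    integral_congr_ae (Eventually.of_forall fun x => by ring)
  rw [e, iterate_adjoint hAK hAK' hadj k hg hg]

include hAK hAK' hadj in
/-- Equal Abel autocorrelation sums for an adjoint pair (every `g ∈ A`, every `r`). -/
theorem abelSum_eq_of_adjoint {g : X → ℝ} (hg : A g) (r : ℝ) :
    ∑' k, (∫ x, g x * (K^[k] g) x * w x ∂μ) * r ^ k
      = ∑' k, (∫ x, g x * (K'^[k] g) x * w x ∂μ) * r ^ k :=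
  tsum_congr fun k => by rw [autocov_eq_of_adjoint hAK hAK' hadj hg k]

include hAK hAK' hadj in
/-- Equal `τ_int` (`Scoring.tauInt` of the normalised autocovariances) for an adjoint pair. -/
theorem tauInt_eq_of_adjoint {g : X → ℝ} (hg : A g) :
    tauInt (fun n => (∫ x, g x * (K^[n] g) x * w x ∂μ) / ∫ x, g x ^ 2 * w x ∂μ)
      = tauInt (fun n => (∫ x, g x * (K'^[n] g) x * w x ∂μ) / ∫ x, g x ^ 2 * w x ∂μ) := by
  have e : (fun n => (∫ x, g x * (K^[n] g) x * w x ∂μ) / ∫ x, g x ^ 2 * w x ∂μ)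
      = fun n => (∫ x, g x * (K'^[n] g) x * w x ∂μ) / ∫ x, g x ^ 2 * w x ∂μ := by
    funext n; rw [autocov_eq_of_adjoint hAK hAK' hadj hg n]
  rw [e]

include hadj in
/-- **Equal Dirichlet forms**: `∫ v (K v) w = ∫ v (K' v) w` on the class. -/
theorem quadForm_eq_of_adjoint {v : X → ℝ} (hv : A v) :
    ∫ x, v x * K v x * w x ∂μ = ∫ x, v x * K' v x * w x ∂μ := by
  have e : ∫ x, v x * K v x * w x ∂μ = ∫ x, K v x * v x * w x ∂μ :=
    integral_congr_ae (Eventually.of_forall fun x => by ring)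
  rw [e, hadj hv hv]

include hAK hAK' hadj in
/-- **The adjoint of a contraction is a contraction** on the class:
`∫ (K f)² w ≤ ∫ f² w` for all `f ∈ A` ⇒ `∫ (K' f)² w ≤ ∫ f² w` for all `f ∈ A`. -/
theorem contr_of_adjoint (hw0 : ∀ x, 0 ≤ w x)
    (hAi : ∀ ⦃f h : X → ℝ⦄, A f → A h → Integrable (fun x => f x * h x * w x) μ)
    (hcontr : ∀ ⦃f : X → ℝ⦄, A f → ∫ x, K f x ^ 2 * w x ∂μ ≤ ∫ x, f x ^ 2 * w x ∂μ) :
    ∀ ⦃f : X → ℝ⦄, A f → ∫ x, K' f x ^ 2 * w x ∂μ ≤ ∫ x, f x ^ 2 * w x ∂μ := by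
  intro f hf
  have hf' := hAK' hf
  have ha0 : 0 ≤ ∫ x, K' f x ^ 2 * w x ∂μ := integral_nonneg fun x => mul_nonneg (sq_nonneg _) (hw0 x)
  have hP0 : 0 ≤ ∫ x, f x ^ 2 * w x ∂μ := integral_nonneg fun x => mul_nonneg (sq_nonneg _) (hw0 x)
  -- `‖K' f‖² = ∫ (K K' f) f w`
  have h1 : ∫ x, K' f x ^ 2 * w x ∂μ = ∫ x, K (K' f) x * f x * w x ∂μ := by
    rw [hadj hf' hf]
    exact integral_congr_ae (Eventually.of_forall fun x => by ring)
  -- Cauchy–Schwarz and the contraction property of `K`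
  have hcs := sq_integral_mul_le hw0 hAi (hAK hf') hf
  have hc := hcontr hf'
  have h2 : (∫ x, K' f x ^ 2 * w x ∂μ) ^ 2 ≤ (∫ x, K' f x ^ 2 * w x ∂μ) * ∫ x, f x ^ 2 * w x ∂μ :=
    calc (∫ x, K' f x ^ 2 * w x ∂μ) ^ 2 = (∫ x, K (K' f) x * f x * w x ∂μ) ^ 2 := by rw [h1]
      _ ≤ (∫ x, K (K' f) x ^ 2 * w x ∂μ) * ∫ x, f x ^ 2 * w x ∂μ := hcs
      _ ≤ (∫ x, K' f x ^ 2 * w x ∂μ) * ∫ x, f x ^ 2 * w x ∂μ := mul_le_mul_of_nonneg_right hc hP0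
  rcases eq_or_lt_of_le ha0 with hz | hpos
  · rw [← hz]; exact hP0
  · exact le_of_mul_le_mul_left (by nlinarith [h2]) hpos

end Adjoint

/-! ## §2 The additive reversibilization `S = ½(K + K')` -/

section AddRev

variable (hw0 : ∀ x, 0 ≤ w x)
  (hAi : ∀ ⦃f h : X → ℝ⦄, A f → A h → Integrable (fun x => f x * h x * w x) μ)
  (hAc : ∀ ⦃f h : X → ℝ⦄ (c : ℝ), A f → A h → A (fun x => f x + c * h x))
  (hAK : ∀ ⦃f : X → ℝ⦄, A f → A (K f)) (hAK' : ∀ ⦃f : X → ℝ⦄, A f → A (K' f))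
  (hlin : ∀ ⦃f h : X → ℝ⦄ (c : ℝ), A f → A h → ∀ x, K (fun s => f s + c * h s) x = K f x + c * K h x)
  (hlin' : ∀ ⦃f h : X → ℝ⦄ (c : ℝ), A f → A h →
    ∀ x, K' (fun s => f s + c * h s) x = K' f x + c * K' h x)
  (hadj : ∀ ⦃f h : X → ℝ⦄, A f → A h → ∫ x, K f x * h x * w x ∂μ = ∫ x, f x * K' h x * w x ∂μ)
  (hcontr : ∀ ⦃f : X → ℝ⦄, A f → ∫ x, K f x ^ 2 * w x ∂μ ≤ ∫ x, f x ^ 2 * w x ∂μ)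
  (hS : ∀ ⦃f : X → ℝ⦄, A f → ∀ x, S f x = (K f x + K' f x) / 2)

omit [MeasurableSpace X] in
include hAc hAK hAK' hS in
/-- (stab) for `S = ½(K + K')`. -/
theorem addRev_mem : ∀ ⦃f : X → ℝ⦄, A f → A (S f) := fun f hf => by
  rw [show S f = fun x => (K f x + K' f x) / 2 from funext (hS hf)]
  exact half_add_mem hAc (hAK hf) (hAK' hf)

omit [MeasurableSpace X] in
include hAc hlin hlin' hS in
/-- (lin) for `S = ½(K + K')`. -/
theorem addRev_lin : ∀ ⦃f h : X → ℝ⦄ (c : ℝ), A f → A h →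
    ∀ x, S (fun s => f s + c * h s) x = S f x + c * S h x := by
  intro f h c hf hh x
  rw [hS (hAc c hf hh), hS hf, hS hh, hlin c hf hh x, hlin' c hf hh x]
  ring

include hAi hAK hAK' hadj hS in
/-- **(symm) for `S = ½(K + K')`**: the additive reversibilization is reversible on the class. -/
theorem addRev_symm : ∀ ⦃f h : X → ℝ⦄, A f → A h →
    ∫ x, S f x * h x * w x ∂μ = ∫ x, f x * S h x * w x ∂μ := by
  intro f h hf hh
  rw [show S f = fun x => (K f x + K' f x) / 2 from funext (hS hf),
    show S h = fun x => (K h x + K' h x) / 2 from funext (hS hh),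
    integral_half_add_mul hAi (hAK hf) (hAK' hf) hh, hadj hf hh]
  have e : ∫ x, f x * ((K h x + K' h x) / 2) * w x ∂μ = ∫ x, (K h x + K' h x) / 2 * f x * w x ∂μ :=
    integral_congr_ae (Eventually.of_forall fun x => by ring)
  rw [e, integral_half_add_mul hAi (hAK hh) (hAK' hh) hf]
  have a1 : ∫ x, f x * K' h x * w x ∂μ = ∫ x, K' h x * f x * w x ∂μ :=
    integral_congr_ae (Eventually.of_forall fun x => by ring)
  have a2 : ∫ x, K' f x * h x * w x ∂μ = ∫ x, K h x * f x * w x ∂μ := by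
    rw [hadj hh hf]; exact integral_congr_ae (Eventually.of_forall fun x => by ring)
  rw [a1, a2]
  ring

include hw0 hAi hAK hAK' hadj hcontr hS in
/-- (contr) for `S = ½(K + K')` (convexity and `contr_of_adjoint`). -/
theorem addRev_contr : ∀ ⦃f : X → ℝ⦄, A f → ∫ x, S f x ^ 2 * w x ∂μ ≤ ∫ x, f x ^ 2 * w x ∂μ := by
  intro f hf
  rw [show S f = fun x => (K f x + K' f x) / 2 from funext (hS hf)]
  refine (integral_half_add_sq_le hw0 hAi (hAK hf) (hAK' hf)).trans ?_
  have h1 := hcontr hf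
  have h2 := contr_of_adjoint hAK hAK' hadj hw0 hAi hcontr hf
  linarith

include hAi hAK hAK' hadj hS in
/-- **`∫ v (S v) w = ∫ v (K v) w`**: the additive reversibilization has the Dirichlet form of `K`. -/
theorem quadForm_addRev_eq {v : X → ℝ} (hv : A v) :
    ∫ x, v x * S v x * w x ∂μ = ∫ x, v x * K v x * w x ∂μ := by
  have e : ∫ x, v x * S v x * w x ∂μ = ∫ x, S v x * v x * w x ∂μ :=
    integral_congr_ae (Eventually.of_forall fun x => by ring)
  rw [e, show S v = fun x => (K v x + K' v x) / 2 from funext (hS hv),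
    integral_half_add_mul hAi (hAK hv) (hAK' hv) hv, hadj hv hv]
  have e1 : ∫ x, K' v x * v x * w x ∂μ = ∫ x, v x * K' v x * w x ∂μ :=
    integral_congr_ae (Eventually.of_forall fun x => by ring)
  rw [e1, ← quadForm_eq_of_adjoint hadj hv]
  ring

end AddRev

/-! ## §3 The palindrome `P = K ∘ K'`: a positive reversible exact sampler -/

section Palindrome

variable (hw0 : ∀ x, 0 ≤ w x)
  (hAi : ∀ ⦃f h : X → ℝ⦄, A f → A h → Integrable (fun x => f x * h x * w x) μ)
  (hAc : ∀ ⦃f h : X → ℝ⦄ (c : ℝ), A f → A h → A (fun x => f x + c * h x))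
  (hAK : ∀ ⦃f : X → ℝ⦄, A f → A (K f)) (hAK' : ∀ ⦃f : X → ℝ⦄, A f → A (K' f))
  (hlin : ∀ ⦃f h : X → ℝ⦄ (c : ℝ), A f → A h → ∀ x, K (fun s => f s + c * h s) x = K f x + c * K h x)
  (hlin' : ∀ ⦃f h : X → ℝ⦄ (c : ℝ), A f → A h →
    ∀ x, K' (fun s => f s + c * h s) x = K' f x + c * K' h x)
  (hadj : ∀ ⦃f h : X → ℝ⦄, A f → A h → ∫ x, K f x * h x * w x ∂μ = ∫ x, f x * K' h x * w x ∂μ)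
  (hcontr : ∀ ⦃f : X → ℝ⦄, A f → ∫ x, K f x ^ 2 * w x ∂μ ≤ ∫ x, f x ^ 2 * w x ∂μ)
  (hP : ∀ ⦃f : X → ℝ⦄, A f → ∀ x, P f x = K (K' f) x)

omit [MeasurableSpace X] in
include hAK hAK' hP in
/-- (stab) for the palindrome `P = K ∘ K'`. -/
theorem palin_mem : ∀ ⦃f : X → ℝ⦄, A f → A (P f) := fun f hf => by
  rw [show P f = K (K' f) from funext (hP hf)]; exact hAK (hAK' hf)

omit [MeasurableSpace X] in
include hAc hAK' hlin hlin' hP in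
/-- (lin) for the palindrome. -/
theorem palin_lin : ∀ ⦃f h : X → ℝ⦄ (c : ℝ), A f → A h →
    ∀ x, P (fun s => f s + c * h s) x = P f x + c * P h x := by
  intro f h c hf hh x
  rw [hP (hAc c hf hh), hP hf, hP hh, show K' (fun s => f s + c * h s) = fun s => K' f s + c * K' h s
    from funext (hlin' c hf hh)]
  exact hlin c (hAK' hf) (hAK' hh) x

include hAK' hadj hP in
/-- **(symm) for the palindrome**: `∫ (P f) h w = ∫ (K' f)(K' h) w = ∫ f (P h) w`. -/
theorem palin_symm : ∀ ⦃f h : X → ℝ⦄, A f → A h →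
    ∫ x, P f x * h x * w x ∂μ = ∫ x, f x * P h x * w x ∂μ := by
  intro f h hf hh
  rw [show P f = K (K' f) from funext (hP hf), show P h = K (K' h) from funext (hP hh),
    hadj (hAK' hf) hh]
  have e1 : ∫ x, f x * K (K' h) x * w x ∂μ = ∫ x, K (K' h) x * f x * w x ∂μ :=
    integral_congr_ae (Eventually.of_forall fun x => by ring)
  rw [e1, hadj (hAK' hh) hf]
  exact integral_congr_ae (Eventually.of_forall fun x => by ring)

include hw0 hAi hAK hAK' hadj hcontr hP in
/-- (contr) for the palindrome. -/
theorem palin_contr : ∀ ⦃f : X → ℝ⦄, A f → ∫ x, P f x ^ 2 * w x ∂μ ≤ ∫ x, f x ^ 2 * w x ∂μ := by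
  intro f hf
  rw [show P f = K (K' f) from funext (hP hf)]
  exact (hcontr (hAK' hf)).trans (contr_of_adjoint hAK hAK' hadj hw0 hAi hcontr hf)

include hw0 hAK' hadj hP in
/-- **(pos) for the palindrome**: `∫ f (P f) w = ∫ (K' f)² w ≥ 0`. -/
theorem palin_pos : ∀ ⦃f : X → ℝ⦄, A f → 0 ≤ ∫ x, f x * P f x * w x ∂μ := by
  intro f hf
  have e1 : ∫ x, f x * P f x * w x ∂μ = ∫ x, K (K' f) x * f x * w x ∂μ :=
    integral_congr_ae (Eventually.of_forall fun x => by
      show f x * P f x * w x = K (K' f) x * f x * w x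
      rw [hP hf]; ring)
  rw [e1, hadj (hAK' hf) hf]
  exact integral_nonneg fun x => by
    have : K' f x * K' f x * w x = K' f x ^ 2 * w x := by ring
    rw [this]; exact mul_nonneg (sq_nonneg _) (hw0 x)

include hw0 hAK hAK' hadj hP in
/-- **Under the palindrome every observable has NONNEGATIVE autocovariances at every lag.** -/
theorem palin_autocov_nonneg {u : X → ℝ} (hu : A u) (k : ℕ) :
    0 ≤ ∫ x, u x * (P^[k] u) x * w x ∂μ :=
  autocov_nonneg_of_pos hw0 (palin_mem hAK hAK' hP) (palin_symm hAK' hadj hP)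
    (palin_pos hw0 hAK' hadj hP) hu k

include hw0 hAi hAc hAK hAK' hlin hlin' hadj hcontr hP in
/-- **Under the palindrome every observable decorrelates MONOTONICALLY**: `C_P(k+1) ≤ C_P(k)`. -/
theorem palin_autocov_succ_le {u : X → ℝ} (hu : A u) (k : ℕ) :
    ∫ x, u x * (P^[k + 1] u) x * w x ∂μ ≤ ∫ x, u x * (P^[k] u) x * w x ∂μ :=
  autocov_succ_le_of_pos hw0 hAi hAc (palin_mem hAK hAK' hP) (palin_lin hAc hAK' hlin hlin' hP)
    (palin_symm hAK' hadj hP) (palin_contr hw0 hAi hAK hAK' hadj hcontr hP)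
    (palin_pos hw0 hAK' hadj hP) hu k

end Palindrome

end RevOp

end Summit.Ventures.LatticeQCDFlow.Exactness
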